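import Summits.Ventures.DiscreteObjects.PP12.PrimeList

/-!
# PP(12): prime-order collineations — the kernel-checked structure theorem (summary of the B1-p / B1-p+ chain)
Framing: lottery ticket; floor = certified bounds/negative ranges.

One statement collecting what the cell `pub-namedobj` (target M) has PROVED in Lean about a non-trivial
collineation `σ` of a projective plane of order 12 (Mathlib `Configuration.ProjectivePlane`) with `σ ^ p = 1` on
points, `p` prime (`prime_order_structure_order12`):

* `p ∈ {2, 3, 5, 11, 13, 157}` (`p = 7` is impossible: `NoOrderSeven`; `p > 13`, `p ≠ 157` impossible: `PrimeList`);
* `p = 11` ⇒ HOMOLOGY (an axis `l`, a centre `c ∉ l`, exactly 14 fixed points) or TRIANGLE (exactly 3 fixed points and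
  3 fixed lines, every fixed line carrying exactly 2 fixed points) — FAMILY-B1P Lemma 4;
* `p = 13` ⇒ exactly one fixed point and exactly one fixed line, not incident (ANTIFLAG) — FAMILY-B1P-PLUS Lemma 5;
* `p = 157` ⇒ no fixed point (Singer type).

What is NOT in the kernel (paper + census): the normal forms of the homology / triangle / antiflag cases
(`OrderElevenCollineation.QdmRows`, `TriangleData.Valid`, `OrderThirteenCollineation.LiftData.Valid`) and their
emptiness at `n = 12` (typed statements `NoCollineationOfOrderEleven`, `NoLiftData13`, certified by exhaustive
search on two implementations each, farm jobs j097463 / j098200); `p = 157` ⇔ cyclic (157,13,1) difference set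
(control B2, signed); `p = 5` (Janko–van Trung 1982, not reproduced). In print all of `p ∈ {5, 7, 11, 13, 157}` are
excluded (Janko–van Trung, Geom. Dedicata 12 (1982) 101–110: the full collineation group is a `{2,3}`-group).
-/

namespace Summit.Ventures.DiscreteObjects.PP12

open Configuration Finset

namespace Collineation

variable {P L : Type*} [Membership P L] [ProjectivePlane P L] [Fintype P] [Fintype L]
  [DecidableEq P] [DecidableEq L] (σ : Collineation P L)

omit [DecidableEq L] in
/-- `p = 157 = v`: a non-trivial collineation with `σ ^ 157 = 1` on a plane of order 12 has no fixed point. -/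
theorem fixedCard_eq_zero_of_pow_157 (h12 : ProjectivePlane.order P L = 12) (hne : σ.onPoints ≠ 1)
    (hq : σ.onPoints ^ 157 = 1) : fixedCard σ.onPoints = 0 := by
  classical
  haveI : Fact (Nat.Prime 157) := ⟨by norm_num⟩
  have hmod := σ.card_fixedPoints_modEq_card hq
  rw [h12] at hmod; norm_num at hmod
  -- fixedCard ≤ 157 = number of points, and ≡ 157 ≡ 0 (mod 157)
  have hle : fixedCard σ.onPoints ≤ Fintype.card P := by
    unfold fixedCard; exact Finset.card_le_univ _
  rw [ProjectivePlane.card_points P L, h12] at hle; norm_num at hle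
  unfold Nat.ModEq at hmod
  by_contra h0
  -- then fixedCard = 157: every point is fixed, so σ = 1
  have h157 : fixedCard σ.onPoints = 157 := by omega
  apply hne
  ext x
  have hall : (univ.filter fun y : P => σ.onPoints y = y) = univ := by
    apply Finset.eq_univ_of_card
    unfold fixedCard at h157
    rw [h157, ProjectivePlane.card_points P L, h12]; norm_num
  have : x ∈ univ.filter fun y : P => σ.onPoints y = y := by rw [hall]; exact mem_univ x
  simpa using this

/-- **Prime-order collineations of a projective plane of order 12 — kernel-checked structure theorem.** -/
theorem prime_order_structure_order12 (h12 : ProjectivePlane.order P L = 12) (hne : σ.onPoints ≠ 1) {p : ℕ}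
    (hp : p.Prime) (hq : σ.onPoints ^ p = 1) :
    p = 2 ∨ p = 3 ∨ p = 5 ∨
    (p = 11 ∧ ((∃ (l : L) (c : P), σ.IsAxis l ∧ σ.IsCenter c ∧ c ∉ l ∧ fixedCard σ.onPoints = 14) ∨
      (fixedCard σ.onPoints = 3 ∧ fixedCard σ.onLines = 3 ∧
        ∀ l : L, σ.onLines l = l → ∀ [DecidablePred (· ∈ l)], σ.fixedOnLine l = 2))) ∨
    (p = 13 ∧ (∃! x : P, σ.onPoints x = x) ∧ (∃! l : L, σ.onLines l = l) ∧
      ∀ (x : P) (l : L), σ.onPoints x = x → σ.onLines l = l → x ∉ l) ∨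
    (p = 157 ∧ fixedCard σ.onPoints = 0) := by
  classical
  rcases σ.prime_of_collineation_order12 h12 hne hp hq with rfl | rfl | rfl | rfl | rfl | rfl
  · exact Or.inl rfl
  · exact Or.inr (Or.inl rfl)
  · exact Or.inr (Or.inr (Or.inl rfl))
  · -- p = 11
    refine Or.inr (Or.inr (Or.inr (Or.inl ⟨rfl, ?_⟩)))
    by_cases hax : ∃ l : L, σ.IsAxis l
    · obtain ⟨l, hl⟩ := hax
      obtain ⟨c, hc⟩ := σ.exists_center_of_axis hl
      have hcl : c ∉ l := σ.center_not_mem_axis_order12_q11 h12 hne hq hl hc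
      refine Or.inl ⟨l, c, hl, hc, hcl, ?_⟩
      rw [σ.fixedCard_eq_of_homology hl hc hcl hne, h12]
    · push Not at hax
      refine Or.inr ⟨σ.fixedCard_points_eq_three_of_no_axis h12 hne hq hax,
        σ.fixedCard_lines_eq_three_of_no_axis h12 hne hq hax, fun l hl inst => ?_⟩
      exact σ.fixedOnLine_eq_two_of_no_axis h12 hne hq hax hl
  · -- p = 13
    refine Or.inr (Or.inr (Or.inr (Or.inr (Or.inl ⟨rfl, σ.existsUnique_fixed_point_q13 h12 hne hq,
      σ.existsUnique_fixed_line_q13 h12 hne hq, fun x l hx hl => ?_⟩))))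
    exact σ.fixed_point_not_mem_fixed_line_q13 h12 hne hq hx hl
  · -- p = 157
    exact Or.inr (Or.inr (Or.inr (Or.inr (Or.inr ⟨rfl, σ.fixedCard_eq_zero_of_pow_157 h12 hne hq⟩))))

end Collineation

end Summit.Ventures.DiscreteObjects.PP12
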